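import Literature.Barriers.ResolutionOfSingularities.KangarooShadeIncrease
import Mathlib.FieldTheory.Perfect
import Mathlib.Data.Prod.Lex
import Mathlib.Data.List.Lex
import HarnessLib

/-!
# Point blow-ups of purely inseparable hypersurfaces: the state `(F, r)`, its shade, the
  "drops / stalls / increases" predicates, and the value types of the classical invariants

Statement-level typing — definitions with bodies and a few proved sanity theorems; NO published
theorem is asserted here as a fact — of

1. the objects behind Hauser's account [Hauser2010, §§F–G] of the characteristic-`p` behaviour of
   the pair (order, shade) for `f = x^q + F(y)`, `q = p^e`, under the blow-up of a POINT:
   the chart transform `PointBlowup.chartTransform` (`y_i ↦ y_i·y_j` for `i ≠ j`, division by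
   `y_j^q`), the translation `PointBlowup.translate` to a point of the exceptional divisor, the
   cleaning `Hauser2010.deletePthPowers q` (the coordinate change `x ↦ x + h(y)`), the state
   `PointBlowup.State = (F, r)` with `shade = ord₀ F − |r|` and the transformation law of the
   exceptional multiplicities (`r'_j = ord₀ F − q`, translated components reset), the predicates
   `IsEquimultiplePoint`, `ShadeDrops / ShadeStalls / ShadeIncreases`, `IsKangarooPoint`,
   `IsAntelopePoint`, Hauser's location condition (3) `AvoidsNonMultiples` (conditions (1)–(2) are
   `Hauser2010.OrderCondition` / `Hauser2010.MultiplicityInequality`), Moh's bound as a PREDICATE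
   `MohBound`, and conditions (6)–(7) of [HauserPerlega2019PRIMS, §3 Theorem];
2. the bridge to the tree's weak-maximal-contact order over graphs
   `Literature.Barriers.ResolutionOfSingularities.graphOrder K q F = ⨆_h ord₀(F + h^q)`
   [Hauser2008Kangaroo]: in characteristic `p` with `q = p^k`, `graphOrder K q F ≤ ord₀(F_clean)`
   (`graphOrder_le_ordZero_deletePthPowers`), with EQUALITY over a perfect ring
   (`graphOrder_eq_ordZero_deletePthPowers`): deleting the `q`-th power monomials realises the
   supremum, so the cleaned-order shade of a state is the tree's `graphShade`
   (`graphShade_eq_shade`);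
3. the ORDER TYPES in which the characteristic-zero invariants take values:
   `BierstoneMilman.InvValue` [BierstoneMilman2008, Thm 7.1], `EncinasHauser.Tag` /
   `EncinasHauser.Invariant n` [EncinasHauser2002, §1], `BEV.TValue` [BravoEncinasVillamayoru2005,
   Part III], `ATW.TruncLex` [AbramovichTemkinWlodarczyk2024, §5.1], `CossartPiltant.IotaValue`
   [CossartPiltant2019, Def. 2.16].

Junk-value conventions (documented at each use): natural-number subtraction in the exponent law
is meaningful under the standing hypothesis `q ≤ ord₀ F` (the origin is a `q`-fold point of
`x^q + F`); `ℕ∞` subtraction in `shade` is meaningful when `y^r ∣ F` (then `|r| ≤ ord₀ F`);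
`(ord₀ F).toNat = 0` for `F = 0` (a resolved, terminal state, never stepped).
-/

open MvPolynomial Finset

open scoped BigOperators

noncomputable section

namespace Literature.AlgebraicGeometry.Resolution

open Literature.AlgebraicGeometry.Resolution.Hauser2010
open Literature.Barriers.ResolutionOfSingularities

/-! ## 1. Frobenius on coefficients for `q = p^k` and the cleaning ↔ graph-order bridge -/

section Cleaning

variable {σ : Type*} {K : Type*} [CommRing K] [DecidableEq σ] (p : ℕ) [Fact p.Prime] [CharP K p]

omit [DecidableEq σ] in
/-- In characteristic `p`, `h^(p^k) = Σ_d c_d^(p^k) · y^{p^k·d}` (the `k`-th iterate of Frobenius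
is additive). [folklore] -/
theorem pow_char_pow_eq_sum_monomial (k : ℕ) (h : MvPolynomial σ K) :
    h ^ p ^ k = ∑ d ∈ h.support, monomial (p ^ k • d) (coeff d h ^ p ^ k) := by
  conv_lhs => rw [h.as_sum]
  rw [sum_pow_char_pow p k]
  refine Finset.sum_congr rfl fun d _ => ?_
  rw [monomial_pow]

/-- Hence a `p^k`-th power has no monomial with an exponent not divisible by `p^k`: adding
`h^(p^k)` (the coordinate change `x ↦ x + h(y)` in `x^(p^k) + F(y)`) cannot cancel such a
monomial of `F`. [folklore] -/
theorem coeff_pow_char_pow_eq_zero (k : ℕ) (h : MvPolynomial σ K) (e : σ →₀ ℕ) (i : σ)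
    (hi : ¬ p ^ k ∣ e i) : coeff e (h ^ p ^ k) = 0 := by
  rw [pow_char_pow_eq_sum_monomial p k h, coeff_sum]
  refine Finset.sum_eq_zero fun d _ => ?_
  rw [coeff_monomial, if_neg]
  rintro rfl
  exact hi ⟨d i, by simp⟩

/-- **Cleaning bounds the order over graphs from above.** For `q = p^k` in characteristic `p`,
no graph hypersurface `x = h(y)` raises the order of `F + h^q` beyond the order of `F` with its
`q`-th power monomials deleted: `⨆_h ord₀(F + h^q) ≤ ord₀(F_clean)` (Hauser 2010, §G: after the
cleaning "no `p`-th powers can be eliminated from `F`"; Moh's "characteristic `p` condition").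
[cite: Hauser2010, §G (cleaning of p-th power monomials)] -/
theorem graphOrder_le_ordZero_deletePthPowers (k : ℕ) (F : MvPolynomial σ K) :
    graphOrder K (p ^ k) F ≤ ordZero (deletePthPowers (p ^ k) F) := by
  by_cases htop : ordZero (deletePthPowers (p ^ k) F) = ⊤
  · rw [htop]; exact le_top
  obtain ⟨n, hn⟩ := ENat.ne_top_iff_exists.mp htop
  obtain ⟨⟨d, hd, hdeg⟩, -⟩ := (ordZero_eq_nat_iff _ n).mp hn.symm
  rw [coeff_deletePthPowers] at hd
  by_cases hP : IsPthPowerExponent (p ^ k) d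
  · rw [if_pos hP] at hd; exact (hd rfl).elim
  rw [if_neg hP] at hd
  obtain ⟨i, hi⟩ : ∃ i, ¬ p ^ k ∣ d i :=
    not_forall.mp (mt (isPthPowerExponent_iff _ _).mpr hP)
  rw [← hn, ← hdeg]
  exact iSup_le fun g => ordZero_le_of_coeff_ne_zero _ d
    (by rwa [coeff_add, coeff_pow_char_pow_eq_zero p k g d i hi, add_zero])

omit [DecidableEq σ] in
/-- **Over a perfect ring the cleaning is realised by a graph.** For `q = p^k` and `K` perfect of
characteristic `p` there is a polynomial `h` with `F + h^q = F_clean`: take for `h` minus the sum of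
the `q`-th roots of the `q`-th power monomials of `F` (Hauser 2010, §G: "apply the coordinate change
`x ↦ x + h(y)` which eliminates all `p`-th power monomials"). [cite: Hauser2010, §G (cleaning of p-th power monomials)] -/
theorem exists_add_pow_eq_deletePthPowers [PerfectRing K p] (k : ℕ) (F : MvPolynomial σ K) :
    ∃ h : MvPolynomial σ K, F + h ^ p ^ k = deletePthPowers (p ^ k) F := by
  refine ⟨∑ d ∈ F.support with IsPthPowerExponent (p ^ k) d,
    monomial (Finsupp.mapRange (· / p ^ k) (Nat.zero_div _) d)
      (((frobeniusEquiv K p).symm : K → K)^[k] (-coeff d F)), ?_⟩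
  have hS : ∀ d ∈ F.support.filter (IsPthPowerExponent (p ^ k)),
      (monomial (Finsupp.mapRange (· / p ^ k) (Nat.zero_div _) d)
        (((frobeniusEquiv K p).symm : K → K)^[k] (-coeff d F))) ^ p ^ k
        = -(monomial d (coeff d F)) := by
    intro d hd
    have hdP : IsPthPowerExponent (p ^ k) d := (Finset.mem_filter.mp hd).2
    have h1 : p ^ k • Finsupp.mapRange (· / p ^ k) (Nat.zero_div _) d = d := by
      ext i
      simp only [Finsupp.coe_smul, Pi.smul_apply, smul_eq_mul, Finsupp.mapRange_apply]
      exact Nat.mul_div_cancel' ((isPthPowerExponent_iff _ _).mp hdP i)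
    have h2 : (((frobeniusEquiv K p).symm : K → K)^[k] (-coeff d F)) ^ p ^ k = -coeff d F :=
      iterate_frobeniusEquiv_symm_pow_p_pow K p (-coeff d F) k
    rw [monomial_pow, h1, h2, map_neg]
  have hsplit : (∑ d ∈ F.support with IsPthPowerExponent (p ^ k) d, monomial d (coeff d F))
      + deletePthPowers (p ^ k) F = F := by
    have := Finset.sum_filter_add_sum_filter_not F.support (IsPthPowerExponent (p ^ k))
      (fun d => monomial d (coeff d F))
    rw [← F.as_sum] at this
    exact this
  rw [sum_pow_char_pow p k, Finset.sum_congr rfl hS, Finset.sum_neg_distrib]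
  linear_combination (-1 : MvPolynomial σ K) * hsplit

/-- **The shade computed by cleaning IS the shade over graphs (perfect ground ring).** For
`q = p^k`, `⨆_h ord₀(F + h^q) = ord₀(F_clean)`. [cite: Hauser2010, §G (cleaning of p-th power monomials)] -/
theorem graphOrder_eq_ordZero_deletePthPowers [PerfectRing K p] (k : ℕ) (F : MvPolynomial σ K) :
    graphOrder K (p ^ k) F = ordZero (deletePthPowers (p ^ k) F) := by
  refine le_antisymm (graphOrder_le_ordZero_deletePthPowers p k F) ?_
  obtain ⟨h, hh⟩ := exists_add_pow_eq_deletePthPowers p k F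
  rw [← hh]
  exact ordZero_le_graphOrder (p ^ k) F h

end Cleaning

/-! ## 2. The point-blow-up state `(F, r)` and its shade -/

namespace PointBlowup

variable {σ : Type*} {K : Type*} [CommRing K]

/-- The exponent law of the `y_j`-chart of the blow-up of the origin followed by division by
`y_j^q`: `y^d ↦ y^{d'}` with `d'_i = d_i` (`i ≠ j`) and `d'_j = |d| − q` (Hauser 2010, §F: in the
`y_j`-chart the total transform of `x^q + F` is divisible by `y_j^q`). Natural-number subtraction:
meaningful when `q ≤ |d|` for every monomial of `F`, i.e. `q ≤ ord₀ F`.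
[cite: Hauser2010, §F (chart expressions of a point blowup)] -/
def chartExponent [DecidableEq σ] (q : ℕ) (j : σ) (d : σ →₀ ℕ) : σ →₀ ℕ :=
  d.update j (d.degree - q)

/-- The **chart transform** `F' = F(…, y_i y_j, …, y_j, …) / y_j^q` of `F` in the `y_j`-chart of
the point blow-up (the new equation is `x^q + F'` after dividing the total transform by `y_j^q`).
[cite: Hauser2010, §F (chart expressions of a point blowup)] -/
def chartTransform [DecidableEq σ] (q : ℕ) (j : σ) (F : MvPolynomial σ K) : MvPolynomial σ K :=
  ∑ d ∈ F.support, monomial (chartExponent q j d) (coeff d F)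

/-- **Translation** `y_i ↦ y_i + b_i`: moving the point `b` of the chart to the origin (points of
the exceptional divisor `y_j = 0` have `b_j = 0`). [folklore] -/
def translate (b : σ → K) (G : MvPolynomial σ K) : MvPolynomial σ K :=
  aeval (fun i => (X i + C (b i) : MvPolynomial σ K)) G

/-- A **state** of the walk: the residual polynomial `F` of `x^q + F(y)` (kept cleaned of `q`-th
power monomials) together with the multiplicities `r` of the exceptional divisor `D = {y^r = 0}`
through the point (Hauser 2010, §F: "`f = x^p + y^r·g(y)`", `D` given by `y^r`).
[cite: Hauser2010, §F (setting f = x^p + y^r g)] -/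
structure State (σ : Type*) (K : Type*) [CommRing K] where
  /-- the residual polynomial `F(y)` of `x^q + F(y)` -/
  F : MvPolynomial σ K
  /-- the exceptional multiplicities `r`, `D = {y^r = 0}` -/
  r : σ →₀ ℕ

namespace State

/-- The order `ord₀ F` of the residual polynomial at the point. [cite: Hauser2010, §C (order of X at a point)] -/
def order (s : State σ K) : ℕ∞ := ordZero s.F

/-- The **shade** of the state: `ord₀ F − |r|`, i.e. `ord₀ g` for `F = y^r·g` — "the order of the
factor `g(y)` at the point", the second component of the local resolution invariant (Hauser 2010,
§F). `ℕ∞` subtraction: meaningful when `y^r ∣ F` (`|r| ≤ ord₀ F`); `⊤` for `F = 0`.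
[cite: Hauser2010, §F (definition of the shade)] -/
def shade (s : State σ K) : ℕ∞ := ordZero s.F - (s.r.degree : ℕ∞)

end State

/-- The polynomial seen at the point `b` of the `y_j`-chart before cleaning:
`translate b (chartTransform q j F)`. [cite: Hauser2010, §F (chart expressions of a point blowup)] -/
def pointTransform [DecidableEq σ] (q : ℕ) (j : σ) (b : σ → K) (s : State σ K) : MvPolynomial σ K :=
  translate b (chartTransform q j s.F)

/-- **Equimultiple (equiconstant) point**: the order of the transform `x^q + G(y)` at the point of
its strict transform above `b` is again `q`, i.e. `G − G(0)` has order `≥ q` (all monomials of `G`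
of degree `1, …, q − 1` vanish; the constant `G(0)` is absorbed by `x ↦ x + G(0)^{1/q}`).
"Let `a'` be a point above `a` where the order of `X'` has remained constant" (Hauser 2010, §F).
[cite: Hauser2010, §F (equiconstant points)] -/
def IsEquimultiplePoint [DecidableEq σ] (q : ℕ) (j : σ) (b : σ → K) (s : State σ K) : Prop :=
  ∀ d : σ →₀ ℕ, d ≠ 0 → d.degree < q → coeff d (pointTransform q j b s) = 0

/-- The **transformation law of the exceptional multiplicities** under the point blow-up, chart
`y_j`, point `b`: the new component `{y_j = 0}` gets `ord₀ F − q` ("`D'` … is given by `y^{r'}`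
with `r'_j = |r| + ord g − q`", Hauser 2010, §F, here `|r| + ord g = ord₀ F`); an old component
`{y_i = 0}` keeps `r_i` if the point lies on its strict transform (`b_i = 0`) and is lost
(`r_i := 0`) otherwise. `(ord₀ F).toNat − q`: meaningful for `F ≠ 0`, `q ≤ ord₀ F`.
[cite: Hauser2010, §F (transform D' of the exceptional divisor)] -/
def newMult [DecidableEq σ] [DecidableEq K] (q : ℕ) (j : σ) (b : σ → K) (s : State σ K) :
    σ →₀ ℕ :=
  (s.r.filter fun i => b i = 0).update j ((ordZero s.F).toNat - q)

/-- One **step** of the walk at the point `b` of the `y_j`-chart: chart transform, translation,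
cleaning of the `q`-th power monomials (`x ↦ x + h(y)`), and the new multiplicities.
[cite: Hauser2010, §§F–G (point blowup followed by cleaning)] -/
def step [DecidableEq σ] [DecidableEq K] (q : ℕ) (j : σ) (b : σ → K) (s : State σ K) :
    State σ K where
  F := deletePthPowers q (pointTransform q j b s)
  r := newMult q j b s

/-! ### The edge predicates of the atlas -/

/-- The shade **drops** at the equimultiple point `b` of chart `y_j`. [cite: Hauser2010, §F (behaviour of the shade under blowup)] -/
def ShadeDrops [DecidableEq σ] [DecidableEq K] (q : ℕ) (j : σ) (b : σ → K) (s : State σ K) : Prop :=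
  (step q j b s).shade < s.shade

/-- The shade **stalls** (stays the same) at the point. [cite: Hauser2010, §F (behaviour of the shade under blowup)] -/
def ShadeStalls [DecidableEq σ] [DecidableEq K] (q : ℕ) (j : σ) (b : σ → K) (s : State σ K) : Prop :=
  (step q j b s).shade = s.shade

/-- The shade **increases** at the point (the characteristic-`p` phenomenon: "the shade of `f'` at
`a'` may be larger than the shade of `f` at `a`", Hauser 2010, §F). [cite: Hauser2010, §F (increase of the shade)] -/
def ShadeIncreases [DecidableEq σ] [DecidableEq K] (q : ℕ) (j : σ) (b : σ → K) (s : State σ K) : Prop :=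
  s.shade < (step q j b s).shade

/-- **Kangaroo point**: a point `a'` of the exceptional divisor (`b_j = 0`) above `a` at which the
order has remained constant and the shade has increased ("The point `a` … will be called antelope
point, and `a'` kangaroo point", Hauser 2010, §G). [cite: Hauser2010, §G (kangaroo points)] -/
def IsKangarooPoint [DecidableEq σ] [DecidableEq K] (q : ℕ) (j : σ) (b : σ → K) (s : State σ K) : Prop :=
  b j = 0 ∧ IsEquimultiplePoint q j b s ∧ ShadeIncreases q j b s

/-- **Antelope point**: a state above which some kangaroo point exists. [cite: Hauser2010, §G (antelope points)] -/
def IsAntelopePoint [DecidableEq σ] [DecidableEq K] (q : ℕ) (s : State σ K) : Prop :=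
  ∃ (j : σ) (b : σ → K), IsKangarooPoint q j b s

/-! ### Published necessary conditions and bounds, as predicates on a step (never asserted) -/

/-- Kangaroo Theorem, condition (3), read in the `y_j`-chart at the point `b`: "the point `a'`
lies on none of the strict transforms of those components `y_i = 0` of `D` for which `r_i` is not
a multiple of `p`" — the strict transform of `{y_i = 0}` (`i ≠ j`) passes through `b` iff `b_i = 0`
(that of `{y_j = 0}` does not meet the chart). Conditions (1) and (2) are
`Hauser2010.OrderCondition` and `Hauser2010.MultiplicityInequality`.
[cite: Hauser2010, §G Kangaroo Theorem (3)] -/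
def AvoidsNonMultiples (p : ℕ) (j : σ) (b : σ → K) (r : σ →₀ ℕ) : Prop :=
  ∀ i, i ≠ j → b i = 0 → p ∣ r i

/-- The three necessary conditions of the Kangaroo Theorem (order `p` case) evaluated at the state
`s` (antelope) and the point `b` of chart `y_j` (kangaroo): (1) `p ∣ |r| + shade`, (2) the
multiplicity inequality on `r`, (3) the location condition. A PREDICATE: the theorem
"kangaroo point ⇒ (1) ∧ (2) ∧ (3)" is not asserted in this file.
[cite: Hauser2010, §G Kangaroo Theorem (1)–(3)] -/
def HauserConditions [Fintype σ] (p : ℕ) (j : σ) (b : σ → K) (s : State σ K) : Prop :=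
  OrderCondition p (⇑s.r) s.shade.toNat ∧ MultiplicityInequality p (⇑s.r) ∧
    AvoidsNonMultiples p j b s.r

/-- **Moh's bound as a predicate** on one step of order `q = p^e`: `shade' ≤ shade + p^{e−1}`
("the shade of `f'` at an equiconstant point `a'` … satisfies `shade_{a'} f' ≤ shade_a f + p^{e−1}`",
Hauser 2010, §F, after Moh). Not asserted here; the atlas tests it row by row.
[cite: Moh1987, Stability Theorem] -/
def MohBound [DecidableEq σ] [DecidableEq K] (p e : ℕ) (j : σ) (b : σ → K) (s : State σ K) : Prop :=
  (step (p ^ e) j b s).shade ≤ s.shade + ((p ^ (e - 1) : ℕ) : ℕ∞)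

/-- The exceptional components **lost** at the point `b` of the `y_j`-chart of a point blow-up:
`{y_j = 0}` (its strict transform misses the chart) and the `{y_i = 0}` with `b_i ≠ 0` — the index
set `T` of Hauser–Perlega ("the sum ranges over those exceptional components which are lost when
passing from `a` to `a'`"). [cite: HauserPerlega2019PRIMS, §3 Theorem (6)] -/
def lostComponents [Fintype σ] [DecidableEq σ] [DecidableEq K] (j : σ) (b : σ → K) : Finset σ :=
  Finset.univ.filter fun i => i = j ∨ b i ≠ 0

end PointBlowup

namespace HauserPerlega2019

variable {σ : Type*}

/-- Condition (6) of the Hauser–Perlega characterisation of the increase of the residual order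
(order `c = m·p^e`, `ℓ < e` maximal with the initial form `F` a `p^ℓ`-th power): "the residues
`0 ≤ r̄_i < p^{ℓ+1}` of `r_i` modulo `p^{ℓ+1}` satisfy `Σ_{i ∈ T} r̄_i ≤ (b − 1)·p^{ℓ+1}`", `T` the
lost components, `b` the number of `i ∈ T` with `r_i ≢ 0 mod p^{ℓ+1}` (right-hand side in `ℤ`).
For `ℓ = 0` and `T` = all components this is `Hauser2010.MultiplicityInequality`
(`residueInequality_zero_univ_iff`). [cite: HauserPerlega2019PRIMS, §3 Theorem (6)] -/
def ResidueInequality (p ℓ : ℕ) (T : Finset σ) (r : σ → ℕ) : Prop :=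
  ((∑ i ∈ T, r i % p ^ (ℓ + 1) : ℕ) : ℤ) ≤
    (((T.filter fun i => ¬ p ^ (ℓ + 1) ∣ r i).card : ℤ) - 1) * (p ^ (ℓ + 1) : ℕ)

/-- Condition (7): "for `j ∉ T`, the variables `x_j` appear only as `p^e`-th powers in `F(x)`"
(`F` the homogeneous initial-form polynomial of the theorem, `q = p^e`).
[cite: HauserPerlega2019PRIMS, §3 Theorem (7)] -/
def PowersOnlyOutside {K : Type*} [CommSemiring K] (q : ℕ) (T : Finset σ) (F : MvPolynomial σ K) :
    Prop :=
  ∀ d ∈ F.support, ∀ i, i ∉ T → q ∣ d i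

/-- For `ℓ = 0` and `T` the set of all components, condition (6) is literally Hauser's
multiplicity inequality (2). [folklore] -/
theorem residueInequality_zero_univ_iff [Fintype σ] (p : ℕ) (r : σ → ℕ) :
    ResidueInequality p 0 Finset.univ r ↔ MultiplicityInequality p r := by
  simp only [ResidueInequality, MultiplicityInequality, residues, phi, zero_add, pow_one]

end HauserPerlega2019

/-! ## 3. The cleaned shade is the shade over graphs -/

namespace PointBlowup

variable {σ : Type*} {K : Type*} [CommRing K] [DecidableEq σ] (p : ℕ) [Fact p.Prime] [CharP K p]

/-- Over a perfect ring of characteristic `p`, for `q = p^k`, the shade of the CLEANED state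
`(F_clean, r)` equals the tree's shade over graphs `graphShade K q r F = ⨆_h ord₀(F + h^q) − |r|`
of [Hauser2008Kangaroo, §C]: the number the atlas tabulates is Hauser's shade over graph
hypersurfaces. [cite: Hauser2008Kangaroo, §C] -/
theorem graphShade_eq_shade [PerfectRing K p] (k : ℕ) (r : σ →₀ ℕ) (F : MvPolynomial σ K) :
    graphShade K (p ^ k) r F = (State.mk (deletePthPowers (p ^ k) F) r).shade := by
  rw [State.shade, graphShade, graphOrder_eq_ordZero_deletePthPowers p k F]

/-- Sanity check against the tree's kernel-checked kangaroo example [Hauser2003, §14 Ex. 2]: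
the cleaned-shade of `F³ = z⁶(y⁵ + y⁴ + y³ + y²)` with `r = (0, 6)` is `3` in characteristic `2`.
[cite: Hauser2003, §14 Example 2] -/
theorem shade_kangaroo_example (K : Type*) [Field K] [CharP K 2] [PerfectRing K 2] :
    (State.mk (deletePthPowers (2 ^ 1) (kangarooResidual K)) kangarooMult).shade = 3 := by
  rw [← graphShade_eq_shade 2 1 kangarooMult (kangarooResidual K), pow_one]
  exact graphShade_kangaroo K

end PointBlowup

/-! ## 4. Value types of the characteristic-zero invariants -/

namespace BierstoneMilman

/-- The alphabet of `inv`: a pair `(ν, s) ∈ ℚ_{>0} × ℕ` (lexicographic), or the terminal symbols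
`0 < everything < ∞` — "`inv_X` takes values in the set of finite sequences of pairs in `ℚ_{>0} × ℕ`
followed by `0` or `∞`, ordered lexicographically" (BM 2008, Thm 7.1; BM 1997, Thm 1.14).
[cite: BierstoneMilman2008, Thm 7.1] -/
abbrev Letter : Type := WithBot (WithTop (ℚ ×ₗ ℕ))

/-- A value `inv_X(a) = (ν₁(a), s₁(a); …; ν_t(a), s_t(a); ν_{t+1}(a))` with `ν_{t+1}(a) ∈ {0, ∞}`:
the list of pairs and the terminal symbol (`false ↦ 0`, `true ↦ ∞`). Positivity of the `ν_i` and
the bounds `s_i ≤` (number of exceptional hypersurfaces) are side conditions of the theorem, not of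
the type. [cite: BierstoneMilman2008, Thm 7.1] -/
structure InvValue where
  /-- the pairs `(ν_i(a), s_i(a))`, `i = 1, …, t` -/
  pairs : List (ℚ × ℕ)
  /-- the terminal entry `ν_{t+1}(a)`: `false ↦ 0` (the resolved / monomial case), `true ↦ ∞` -/
  terminalIsInfty : Bool

/-- The word over `Letter` that a value spells: pairs, then `⊥` (for `0`) or `↑⊤` (for `∞`). [cite: BierstoneMilman2008, Thm 7.1] -/
def InvValue.key (v : InvValue) : List Letter :=
  v.pairs.map (fun x => (((toLex x : ℚ ×ₗ ℕ) : WithTop (ℚ ×ₗ ℕ)) : Letter)) ++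
    [if v.terminalIsInfty then ((⊤ : WithTop (ℚ ×ₗ ℕ)) : Letter) else (⊥ : Letter)]

/-- The lexicographic order of the values of `inv_X` (every key ends in a terminal letter, so no
key is a proper prefix of another and the treatment of prefixes is immaterial).
[cite: BierstoneMilman2008, Thm 7.1] -/
instance : LT InvValue := ⟨fun v w => v.key < w.key⟩

end BierstoneMilman

namespace EncinasHauser

/-- The **tag** `(o, k, m) ∈ ℕ⁴` of an ideal of a mobile at a point: its order `o`, its transversal
handicap's counter `k`, and its combinatorial pair `m = (m₁, m₂)`, compared lexicographically
(EH 2002, §1 "the local invariant … `i_a(𝓜) = (t_n, …, t_1) ∈ ℕ^{4n}`, each `t_i = (o_i, k_i, m_i)`").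
[cite: EncinasHauser2002, §1 (the resolution invariant)] -/
abbrev Tag : Type := ℕ ×ₗ ℕ ×ₗ (ℕ ×ₗ ℕ)

/-- The **resolution invariant** `i_a(𝓜) = (t_n, t_{n−1}, …, t_1) ∈ ℕ^{4n}` with its lexicographic
order, index `0 ↦ t_n` (the most significant, the tag of the top-dimensional ideal).
[cite: EncinasHauser2002, §1 (the resolution invariant)] -/
abbrev Invariant (n : ℕ) : Type := Lex (Fin n → Tag)

end EncinasHauser

namespace BEV

/-- Villamayor's function `t = (w-ord, n)`: the weighted order `w-ord ∈ ℚ` (order of the basic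
object divided by its weight, after factoring out the exceptional monomial) and the counter `n ∈ ℕ`
of "old" exceptional hypersurfaces, compared lexicographically (BEV 2005, Part III; Villamayor 1989,
Def. 1.17.1 / §2.3). Typed with `ℤ` for the counter as printed values are compared only.
[cite: BravoEncinasVillamayoru2005, Part III (the functions w-ord, n, t)] -/
abbrev TValue : Type := ℚ ×ₗ ℤ

end BEV

namespace CossartPiltant

/-- The numerical character `ι(x) = (m(x), ω(x), κ(x))` of Cossart–Piltant, `m(x) ≤ p`,
`ω(x) ∈ ℕ` the adapted order, `κ(x) ∈ {1, …, 4}`, compared lexicographically ("If `m(x) < p`, we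
let `ι(x) := (m(x), 0, 1)`"). The ranges are side conditions, not part of the type.
[cite: CossartPiltant2019, Def. 2.16] -/
abbrev IotaValue : Type := ℕ ×ₗ ℕ ×ₗ ℕ

end CossartPiltant

namespace ATW

/-- The order on the invariants `inv_p = (a_1, …, a_k)` of Abramovich–Temkin–Włodarczyk:
"lexicographically, with truncated sequences considered LARGER", e.g.
`(1,1,1) < (1,1,2) < (1,2,1) < (1,2) < (2,2,1) < (3)` (ATW, §5.1). `TruncLex.lt a b`: at the first
difference `a_i < b_i`, or `b` is a proper prefix (truncation) of `a`.
[cite: AbramovichTemkinWlodarczyk2024, §5.1 (order of invariants)] -/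
def TruncLex.lt {α : Type*} [LT α] : List α → List α → Prop
  | [], _ => False
  | _ :: _, [] => True
  | x :: xs, y :: ys => x < y ∨ (x = y ∧ TruncLex.lt xs ys)

/-- `TruncLex.lt` is decidable on a decidable linear order. [folklore] -/
instance TruncLex.decLt {α : Type*} [LT α] [DecidableEq α] [DecidableLT α] :
    (a b : List α) → Decidable (TruncLex.lt a b)
  | [], b => by unfold TruncLex.lt; infer_instance
  | x :: xs, [] => by unfold TruncLex.lt; infer_instance
  | x :: xs, y :: ys => by
      unfold TruncLex.lt
      haveI := TruncLex.decLt xs ys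
      infer_instance

/-- The invariant of a point: a finite non-decreasing sequence of positive rationals
`(a_1, …, a_k)`, `k ≤ n`, with `a_1 ∈ ℕ` the order and `b_i·(a_{i−1})!`-integrality (ATW §5.1);
typed as a list of rationals ordered by `TruncLex.lt`, the arithmetic side conditions being part of
the theorem, not of the type. [cite: AbramovichTemkinWlodarczyk2024, §5.1 (order of invariants)] -/
abbrev Invariant : Type := List ℚ

/-- The printed chain `(1,1,1) < (1,1,2) < (1,2,1) < (1,2) < (2,2,1) < (3)` of ATW §5.1 holds for
`TruncLex.lt` (checked over `ℕ`). [cite: AbramovichTemkinWlodarczyk2024, §5.1 (order of invariants)] -/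
theorem truncLex_chain :
    TruncLex.lt [1, 1, 1] [1, 1, 2] ∧ TruncLex.lt [1, 1, 2] [1, 2, 1] ∧
      TruncLex.lt [1, 2, 1] [1, 2] ∧ TruncLex.lt [1, 2] [2, 2, 1] ∧
      TruncLex.lt [2, 2, 1] ([3] : List ℕ) := by
  decide

end ATW

end Literature.AlgebraicGeometry.Resolution

end
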